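import Summits.NavierStokesRegularity.NavierStokesRegularity.Theorems.ExtremiserTransienceTightOrChainDefs
import Summits.NavierStokesRegularity.NavierStokesRegularity.Theorems.ExtremiserTransienceNearExtremalTransiencePerFlowStubUbiquityToLimit
import HarnessLib

/-!
# Route `ExtremiserTransience`, crux `NearExtremalTransiencePerFlow` (stmt-NavierStokesRegularity-26567),
# LINE g10-β «tight-or-chain» — part A: THE CHAIN CALCULUS (walk lemma, limit passage, member-level reductions of T♮)

`--supports stmt-NavierStokesRegularity-26567` (helper).  Theorems-side PORT of §0/§1b of the registered skeleton of record
`Cruxes/NearExtremalTransiencePerFlow/Lines/tight_or_chain.lean` (planner ns-idea-5 g10, sha 0c90497d1ce4) over the texts of record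
`Theorems/ExtremiserTransienceTightOrChainDefs.lean`: the proofs are the line author's (kernel-checked there), copied so that they become
importable theorems (a `Cruxes/` file is not importable from `Theorems/`).  Port by prover seat `ns-net-p1` (g11).

* `chainUpTo_of_walk`, `chainsOfEveryLength_of_walks` — a `g`-walk of level points from `z₀` reaching distance `≥ d` realises a chain of
  length `d` (discrete intermediate-value lemma);
* `shell_points_of_limit` — chains pass to pointwise limits of equi-Lipschitz translates (thickness `g ↦ g+1`, level `η ↦ η/2`); this is the
  landed C2 `DissipationLedger.stub_ubiquityToLimit` (p704099) read through `RadiallyUbiquitous`;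
* `tightOrChain_of_members`, `tightOrChainMembers_of_clusterGrowth`, `tightOrChain_of_clusterGrowth` — the member-level forms of the heart
  T♮ imply T♮.

HONEST FRAMING: elementary; nothing about Navier–Stokes is used or proved; the heart T♮ and the crux stay OPEN; no summit is proved by a line.
[folklore]
-/

noncomputable section

open scoped Topology InnerProductSpace RealInnerProductSpace ENNReal ContDiff
open MeasureTheory Filter Set Metric Function
open Literature.Analysis Literature.Analysis.FluidPDE
open Summit.NavierStokesRegularity.NavierStokesRegularity.Theses.ExtremiserTransience
open Summit.NavierStokesRegularity.NavierStokesRegularity.Theorems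
open Summit.NavierStokesRegularity.NavierStokesRegularity.Theorems.DepletionLadder.KStar.HalfSpace
open Summit.NavierStokesRegularity.NavierStokesRegularity.Theorems.NearExtremalTransiencePerFlow.ZoneTransversality
open Summit.NavierStokesRegularity.NavierStokesRegularity.Theorems.NearExtremalTransiencePerFlow.MemberSelection
open Summit.NavierStokesRegularity.NavierStokesRegularity.Theorems.NearExtremalTransiencePerFlow.DissipationLedger
open Summit.NavierStokesRegularity.NavierStokesRegularity.Theorems.NearExtremalTransiencePerFlow

namespace Summit.NavierStokesRegularity.NavierStokesRegularity.Theorems.NearExtremalTransiencePerFlow.TightOrChain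

-- the problem directory repeats the summit name (`NavierStokesRegularity/NavierStokesRegularity`)
set_option linter.dupNamespace false

/-- **Discrete intermediate-value lemma (how the chain branch is produced in practice).**  A `g`-WALK of level points — finitely many points
`p 0 = z₀, p 1, …, p N` with `η ≤ ‖w (p i)‖`, consecutive steps `‖p (i+1) - p i‖ ≤ g`, reaching `‖p N - z₀‖ ≥ d` — realises `ChainUpTo g η w z₀ d`:
for a radius `r ≤ d` take the FIRST index whose distance from `z₀` is `≥ r`; the previous one is `< r`, so that distance lies in `[r, r + g]`.
In particular every `g`-connected cluster of the level set `{η ≤ ‖w‖}` of diameter `≥ 2d` carries a chain of length `d` about each of its points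
realising the diameter, so T♮'s second branch follows from «the limit has `g`-connected level clusters of every diameter». -/
theorem chainUpTo_of_walk {g η d : ℝ} {w : E3 → E3} {z₀ : E3} {N : ℕ} (hg : 0 ≤ g) (p : ℕ → E3)
    (hp0 : p 0 = z₀) (hlev : ∀ i, i ≤ N → η ≤ ‖w (p i)‖) (hstep : ∀ i, i < N → ‖p (i + 1) - p i‖ ≤ g)
    (hfar : d ≤ ‖p N - z₀‖) : ChainUpTo g η w z₀ d := by
  intro r hr hrd
  classical
  have hex : ∃ i, r ≤ ‖p i - z₀‖ := ⟨N, le_trans hrd hfar⟩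
  have hi₀ : r ≤ ‖p (Nat.find hex) - z₀‖ := Nat.find_spec hex
  have hi₀N : Nat.find hex ≤ N := Nat.find_min' hex (le_trans hrd hfar)
  refine ⟨p (Nat.find hex), ?_, hlev _ hi₀N⟩
  rcases Nat.eq_zero_or_pos (Nat.find hex) with h0 | hpos
  · -- the walk starts at `z₀`, so `r = 0`
    rw [h0, hp0, sub_self, norm_zero] at hi₀
    rw [h0, hp0, sub_self, norm_zero]
    have hr0 : r = 0 := le_antisymm hi₀ hr
    rw [hr0, sub_zero, abs_zero]; exact hg
  · obtain ⟨j, hj⟩ : ∃ j, Nat.find hex = j + 1 := ⟨Nat.find hex - 1, by omega⟩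
    have hjlt : ¬ r ≤ ‖p j - z₀‖ := Nat.find_min hex (by rw [hj]; exact Nat.lt_succ_self j)
    have hjN : j < N := by omega
    have hst := hstep j hjN
    have htri : ‖p (j + 1) - z₀‖ ≤ ‖p (j + 1) - p j‖ + ‖p j - z₀‖ := norm_sub_le_norm_sub_add_norm_sub _ _ _
    rw [hj] at hi₀ ⊢
    rw [abs_le]; constructor <;> linarith [not_le.1 hjlt]

/-- Corollary: walks of every extent give chains of every length. [folklore] -/
theorem chainsOfEveryLength_of_walks {g η : ℝ} {w : E3 → E3} (hg : 0 ≤ g)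
    (h : ∀ d : ℝ, ∃ (z₀ : E3) (N : ℕ) (p : ℕ → E3), p 0 = z₀ ∧ (∀ i, i ≤ N → η ≤ ‖w (p i)‖) ∧
      (∀ i, i < N → ‖p (i + 1) - p i‖ ≤ g) ∧ d ≤ ‖p N - z₀‖) : ChainsOfEveryLength g η w := by
  intro d
  obtain ⟨z₀, N, p, hp0, hlev, hstep, hfar⟩ := h d
  exact ⟨z₀, chainUpTo_of_walk hg p hp0 hlev hstep hfar⟩


/-- **Chains pass to pointwise limits of translates** (thickness `g ↦ g + 1`, level `η ↦ η/2`): if the smooth, equi-Lipschitz (`‖D¹(v n)‖ ≤ Λ₁`)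
members `v n` have level-`η` points within `g` of every sphere about `y n` of radius `≤ d n`, `d n → ∞`, and `v n (y n + ·) → w` pointwise, then
`w` has level-`η/2` points within `g + 1` of every sphere about `0`.  This is the landed C2 `DissipationLedger.stub_ubiquityToLimit`. [folklore] -/
theorem shell_points_of_limit (v : ℕ → E3 → E3) (Λ₁ g η : ℝ) (y : ℕ → E3) (d : ℕ → ℝ) (w : E3 → E3)
    (hcd : ∀ n, ContDiff ℝ (⊤ : ℕ∞) (v n)) (hΛ : ∀ n (x : E3), ‖iteratedFDeriv ℝ 1 (v n) x‖ ≤ Λ₁)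
    (hd : Tendsto d atTop atTop)
    (hub : ∀ n, ∀ r : ℝ, 0 ≤ r → r ≤ d n → ∃ z : E3, |‖z - y n‖ - r| ≤ g ∧ η ≤ ‖v n z‖)
    (hconv : ∀ z : E3, Tendsto (fun n => v n (y n + z)) atTop (𝓝 (w z))) :
    ∀ r : ℝ, 0 ≤ r → ∃ z : E3, |‖z‖ - r| ≤ g + 1 ∧ η / 2 ≤ ‖w z‖ :=
  DissipationLedger.stub_ubiquityToLimit v Λ₁ g η y d w hcd hΛ hd hub hconv

/-- **Kernel-checked reduction T♮ ⇐ T♮ₘₑₘ** (the limit passage of the chain branch is done here once and for all, by `shell_points_of_limit`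
with the family's uniform gradient bound `Λ 1`): member chains about the centres become `ChainsOfEveryLength (g+1) (η/2)` of the limit, all about
the origin of the moving frame. -/
theorem tightOrChain_of_members (h : TightOrChainMembers) : TightOrChain := by
  intro v Λ Θ ε A hfam hgr
  obtain ⟨y, φ, W₀, hφ, hconv, hdich⟩ := h v Λ Θ ε A hfam hgr
  refine ⟨y, φ, W₀, hφ, hconv, ?_⟩
  rcases hdich with hext | ⟨g, η, hη, d, hd, hchain⟩
  · exact Or.inl hext
  · right
    refine ⟨g + 1, η / 2, by linarith, ?_⟩
    have hcd : ∀ n, ContDiff ℝ (⊤ : ℕ∞) (v (φ n)) := fun n => hfam.1 (φ n)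
    have hΛ : ∀ n (x : E3), ‖iteratedFDeriv ℝ 1 (v (φ n)) x‖ ≤ Λ 1 := fun n x => hfam.2.2.2.1 1 (φ n) x
    have hshell := shell_points_of_limit (fun n => v (φ n)) (Λ 1) g η (fun n => y (φ n)) d W₀ hcd hΛ hd
      (fun n r hr hrd => hchain n r hr hrd) hconv
    intro D
    refine ⟨0, fun r hr _ => ?_⟩
    obtain ⟨z, hz, hzη⟩ := hshell r hr
    exact ⟨z, by simpa using hz, hzη⟩


/-- Cluster growth ⇒ member chains (by the walk lemma). [folklore] -/
theorem tightOrChainMembers_of_clusterGrowth (h : TightOrClusterGrowth) : TightOrChainMembers := by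
  intro v Λ Θ ε A hfam hgr
  obtain ⟨y, φ, W₀, hφ, hconv, hdich⟩ := h v Λ Θ ε A hfam hgr
  refine ⟨y, φ, W₀, hφ, hconv, ?_⟩
  rcases hdich with hext | ⟨g, η, hg, hη, d, hd, hwalk⟩
  · exact Or.inl hext
  · refine Or.inr ⟨g, η, hη, d, hd, fun n => ?_⟩
    obtain ⟨N, p, hp0, hlev, hstep, hfar⟩ := hwalk n
    exact chainUpTo_of_walk hg p hp0 hlev hstep hfar

/-- Cluster growth ⇒ T♮ (kernel-checked chain: walk lemma + limit passage). [folklore] -/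
theorem tightOrChain_of_clusterGrowth (h : TightOrClusterGrowth) : TightOrChain :=
  tightOrChain_of_members (tightOrChainMembers_of_clusterGrowth h)

end Summit.NavierStokesRegularity.NavierStokesRegularity.Theorems.NearExtremalTransiencePerFlow.TightOrChain

end
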